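import Literature.MathematicalPhysics.QuantumFieldTheory.BalabanImbrieJaffe1984to88.BIJ88DeltaLoc234Torus
import Literature.MathematicalPhysics.QuantumFieldTheory.BalabanImbrieJaffe1984to88.BIJ85BlockKPoincare
import Literature.MathematicalPhysics.QuantumFieldTheory.Balaban1983to89.B4Thm19ZeroTorus

/-!
# `BalabanImbrieJaffe1984to88.BIJ88NeumannPropagatorFlatDecay` — T. Bałaban, J. Imbrie, A. Jaffe, *Effective action and cluster
properties of the abelian Higgs model*, Commun. Math. Phys. **114** (1988) 257–315 [BalabanImbrieJaffe1988], Sect. 2 p. 262–263 [PDF 6–7],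
(2.30): **[6]'s DECAY THEOREM (1.10)/(1.9) FOR THE TORUS PROPAGATOR OF RECORD `G_k(T_η,u)` AT EVERY PURE-GAUGE BACKGROUND `u = 1^h`** —
hypothesis-free, in the printed SUP-NORM shape, constants depending on `(d, L, a)` only (uniform in the volume, in the level `1 ≤ k ≤ K`
and in the gauge function `h`).

statement-level skeleton of published theorems with citation tags; proofs where landed; nothing here is a claim about the Yang–Mills mass gap

PDF held: `paper:balaban1988-cmp114-bij-abelian-higgs-effective-action` (journal page = PDF page + 256); p. 262–264 [PDF 6–8] re-read this
session (text layer, `lit read … --pages 6-9`); [I] = [BalabanImbrieJaffe1985] (CMP **97**) p. 326 [PDF 28] re-read this session; [6] = [7] of [I] =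
[Balaban1983RegularityDecay] (CMP **89**) p. 573 [PDF 3] as transcribed in the tree's `Balaban1983to89.B4Thm110ZeroTorus` / `B4Thm19ZeroTorus`.

CITATION HEADER (lean-in-tree rule).  Part of the lit-balaban TYPED SKELETON (HOME `run/shared/lean/pub/lit-balaban/`), PHASE-2 proof seat
p31 gen 16 (unit `lit-balaban-p31-g16`; TAKING line HOME/STATUS.md 2026-08-22T13:13:57Z; free-target protocol G.5-34(d) — successor item
(a) of this seat's gen-15 HANDOFF = item 2 (ii) of the owner's `HOME/lit-balaban-r18/C2S14-CLOSURE.md` §5, *"the DECAY inputs (2.30)/(2.31)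
… [6]'s Theorem for p31's concrete `gBox`"*, in its FLAT-BACKGROUND case).  WHAT IS REPRODUCED: the [6]-input of rows **C2.Eq2.30** /
**C2.Eq2.31** (`HOME/lit-balaban-r18/ROWS-C2.md`, owner r18) for the WHOLE-TORUS propagator `G_k(T_η,u)` (`Ω = T`; row **C2.Eq2.27**'s
`G_k(Ω,u)`), and the DECAY SENTENCE of [I] p. 326 (row **C1.Eq7.3.1-7.3.2**, owner r15) in its sup-norm member — at pure-gauge backgrounds.
Kind «model-level theorems only» (no new definition, no `Prop`-valued fact introduced).

THE PRINTED TEXT (verbatim).  C2 p. 262–263 [PDF 6–7]: *"In the scalar field sector, we have the η-lattice propagators G_k(Ω,u) defined on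
subsets Ω ⊂ T_η with Neumann boundary conditions. … The boundary conditions are always at a distance O(r(e_k)) from x₁, x₂, so a
straightforward application of the random walk expansion of [6] shows that |(G_{k,loc}(u)f)(x)| ≤ ce^{−c dist(suppt f, x)}‖f‖_∞, (2.30) …
We assume that u is smooth in the □_α's entering the sum in (2.27) … This means that in a neighborhood of each □_α there exists an A, λ
such that u = exp[ie_kη(A + ∂λ)] with |∂A|, |∂*A| ≤ O(p(e_k)). (2.32)"*.  [I] p. 326 [PDF 28]: *"The propagators arising from Δ_k(u_k), under
the restriction (7.3.1) on the gauge field, also satisfy the regularity and decay estimates of [7]. In order to remain within the framework of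
this reference, we remark that by change of gauge u_k can be transformed in a local region Λ into a configuration of the form exp[ie_kηA],
where A is smooth and small."*  [6] p. 573 [PDF 3] (as transcribed in `B4Thm110ZeroTorus`): *"Theorem (Proposition 2.1 of [1]). For α < 1
there exist positive constants δ₀, c₀, R₀ independent of A, k, Ω … such that for e sufficiently small and for an arbitrary function
f : Ω → R^N, we have |x − x′|^{−α}|U(A(Γ_{x,x′}))(D^η_{A,μ}G_k(Ω, A)f)(x′) − (D^η_{A,μ}G_k(Ω, A)f)(x)| ≤ c₀exp(−δ₀ dist({x, x′}, supp f))‖f‖_∞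
(1.9) … Similarly |(D^η_{A,μ}G_k(Ω, A)f)(x)|, |(G_k(Ω, A)f)(x)| ≤ c₀exp(−δ₀ dist(x, supp f))‖f‖_∞ (1.10) … For some simple sets Ω, e.g. for
rectangular parallelepipeds, the inequalities hold without any restrictions on the points x, x′"*.

THE OBJECT.  `G_k(T_η,u)` = this seat's gen-15 `BIJ88NeumannPropagator227Torus.gBox a c U k univ` at `Ω = T^{(0)}` (the whole fine torus
`Site P 0` of `Setup`, `2L^{m+K}` sites per direction), `U : GaugeField P 0 U1`, block level `k` (`Site P (0+k)`), `c = ε⁻¹` the covariant-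
derivative scale and the `Q_k^*Q_k`-coefficient `α_k·L^{kd}`, `α_k = a_k(L^kε)^{−2}` = pv07's `B1RG242Torus.α P a k` (running coefficient
`a_k = B1.aSeq a L k` of [I] (2.16)/[B1] (2.15); at the unit block lattice `k = K`, `L^Kε = 1`, this is `a_K·η^{−d}`): in the COUNTING-MEASURE
matrix normalization of gen 15 (*"uniform lattice weights are absorbed into c, a and L^{−kd}"*) these are exactly the parameters for which
`nOp` IS the printed operator `−Δ^η_u + a_kQ_k^*(u)Q_k(u)` of [I] (4.6.2) / [6] (1.6) acting on functions (`⟨·,·⟩_η`-adjoints), i.e. for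
which `nOp … 1 k univ` coincides entrywise with pv07's B1/B4 tower operator `H + α_k•Q_k^*Q_k` on `Site P 0` (§2 below) — and `gBox` with
its inverse `(tower P a 0).G k`, [6]'s `G_k(T_η, 0)`.

THE MECHANISM (the printed one, [I] p. 326: *"by change of gauge u_k can be transformed … into a configuration of the form exp[ie_kηA]"* —
here `A = 0`).  (§1) At the flat background `u = 1` the composite-contour transports of the `k`-level average of record are `1`
(`holCK_flat`), so `Q_k(1)` is the plain block average.  (§2) ENTRYWISE BRIDGE: the Laplacian Gram matrix `(χD₁)ᴴ(χD₁)` of gen 15 is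
`ε^{−2}Σ_μ ∂_μᵀ∂_μ` of pv07 (`gram_dN_flat_apply` / `towerLap_apply`, bonds `⟨z, z+e_μ⟩` ↔ pairs `(z, μ)`), the block Gram matrix
`(Q_k|_T)ᴴ(Q_k|_T)` is `L^{−2kd}·[x, x′ in the same k-block]` and pv07's `Q_k^*Q_k` is `L^{−kd}·[Site.proj x = Site.proj x′]`
(`gram_qMatK_flat_apply` / `towerQ_apply`), the two block relations agreeing label by label (`blkIter_eq_iff_proj_eq`, p33's `val_blkIter`
and pv07's `Site.val_proj`); whence **`nOp_flat_eq_tower`**: `nOp (α_kL^{kd}) ε⁻¹ 1 k univ = (H P 0 + α_k•(Q_k^*Q_k)).map ofReal` and, by the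
uniqueness of the inverse on `ℓ²(T)` (gen 15 `eq_gBox_of_right_inverse`, pv07 `G_arg`), **`gBox_flat_eq_tower`**: `G_k(T,1) =
((tower P a 0).G k).map ofReal`.  (§3) GAUGE COVARIANCE (gen 15 `gBox_gaugeAct`): `G_k(T,1^h) = M_hG_k(T,1)M_hᴴ`, so
`(G_k(T,1^h)f)(x) = h(x)·(G_k(T,1)(h̄f))(x)` and `ε⁻¹(u_b(G f)(b₊) − (G f)(b₋)) = h(b₋)·(∂_μG_k(T,1)(h̄f))(b₋)` for `u = 1^h`.
(§4) [6]'s Theorem AT `A = 0` ON THE TORUS, BY NAME — p38's `B4Thm110ZeroTorus.thm110_zero_torus` ((1.10), value and derivative) and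
`B4Thm19ZeroTorus.thm19_zero_torus` ((1.9)) for `(tower P a m²).G k` acting on REAL sources — applied to the real and imaginary parts of the
rotated complex source `h̄f` (`|Re|, |Im| ≤ ‖f‖_∞`, same support), the phases `h(x)` having modulus one.

WHAT IS PROVED (theorems only; 0 `sorry`; standard axioms; no new definition, no `Prop`-valued fact).
* §1 `cfg_flat`, `holCK_flat`, `qMatK_flat_apply`, `dN_univ_apply`.
* §2 `dN_flat_apply`, `gram_dN_flat_apply`, `gram_qMatK_flat_apply`, `blkIter_eq_iff_proj_eq`, `towerLap_apply`, `towerQ_apply`, `nOp_flat_apply`,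
  **`nOp_flat_eq_tower`**, `proj_univ`, **`gBox_flat_eq_tower`**, `gBox_flat_apply` (the entries of `G_k(T,1)` are the real numbers
  `(tower P a 0).G k x y`), `alpha_top` (the `k = K` reading: `α_K = a_K`, the running coefficient of [I] (2.16)).
* §3 `gBox_pureGauge` (`G_k(T,1^h) = M_h·G_k(T_η,0)·M_hᴴ`), `mulOp_conjTranspose_mulVec`, `mulOp_mulVec`, `gBox_pureGauge_mulVec`, `norm_rot`,
  `rot_ne_zero_iff`, `covD_gBox_pureGauge` (+ private `re_map_mulVec`, `im_map_mulVec`, `norm_map_mulVec_le`, `norm_sub_le_re_im`).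
* §4 **`decay110_flat`** — (1.10) for `G_k(T_η, 1^h)`: `∃ δ₀ c₀ > 0` (from `(d, L, a)`) such that for every volume `P` with `P.d = d`,
  `P.L = L`, every `1 ≤ k ≤ K`, every `h : T^{(0)} → U(1)`, every `x`, every complex source `f` with `‖f‖ ≤ F` supported at sup-torus
  distance `≥ D` (lattice units) from `x`: `‖(G_k(T,1^h)f)(x)‖ ≤ c₀e^{−δ₀εD}F` AND, for every bond direction `μ`,
  `‖ε⁻¹(u_{⟨x,x+e_μ⟩}(G f)(x+e_μ) − (G f)(x))‖ ≤ c₀e^{−δ₀εD}F` (`u = 1^h`; the printed `D^η_{A,μ}G_k f`, r18's `covD`); **`decay110_flat_kernel`**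
  — the kernel form `‖G_k(T,1^h; x, y)‖ ≤ c₀e^{−δ₀ε|x−y|_T}`; **`holder19_flat`** — (1.9): `∃ δ₀ > 0 ∀ α ∈ [0,1) ∃ c₀ > 0 …
  (ε|x₁−x₂|_T)^{−α}‖u(Γ_{x₁x₂})(D_uG f)(x₂,μ) − (D_uG f)(x₁,μ)‖ ≤ c₀e^{−δ₀εD}F` with the pure-gauge transport `u(Γ_{x₁x₂}) = h(x₁)h(x₂)^{−1}`
  (path-independent at a flat background) written out.
HONEST SCOPE.  (i) FLAT BACKGROUNDS ONLY (`A = 0` up to gauge): at a (1.7)-regular `A ≠ 0` the B4 torus family of record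
`Balaban1983to89.B4ThmTorusPairEta` transports along STAIRCASE contours (`rstairContour`), a different averaging operator from the
COMPOSITE-contour `Q_k(u)` of [I] (5.1.2)–(5.1.3) used by `gBox` (p11's `qCovK`/`holCK`), so [6]'s Theorem for `G_k(T_η,u)` at general
(2.32)-smooth `u` (the remaining part of the owner's item 2 (ii)) is NOT obtained here and stays a statement row ([6] = B4.Thm@573); at
`u = 1` every contour transports by `1` and the two operators coincide (§2).  (ii) WHOLE TORUS `Ω = T` only (*"for rectangular
parallelepipeds, the inequalities hold without any restrictions on the points"*): the cube propagators `G_k(□_α,u)` of (2.27) would need the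
analogous bridge to B4's zero-field BOX theorems (`B4Thm110ZeroBox`, carrier `boxDom`), not built.  (iii) Fine level `j = 0` (the tower's
`Site P 0`), `1 ≤ k ≤ K`, `m² = 0`; sup TORUS metric `B5Ineq137Torus.T` in lattice units (`ε·T` = the printed distance, `ℓ^∞` reading as in
p38's file); complex sources (the printed `f : Ω → R^N`, `N = 2`), constants `2c₀` of the zero-field theorem.  (iv) p33's
`BIJ85ScalarPropagatorDecay`/`BIJ85Claim73PropagatorDecay` give the `L²`-PAIRING decay of `G_k(u)` for every small-plaquette `u` (Agmon route;
pointwise constant `2η^{−d}/m′`); this file is the complementary sup-norm (1.10) shape with `k`-uniform constants, at flat `u`.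
Imports: this seat's `BIJ88DeltaLoc234Torus` (→ `BIJ88NeumannPropagator227Torus`, `gBox_gaugeAct`), p33's `BIJ85BlockKPoincare`
(`val_blkIter`; → p11's `BIJ85BlockAveragingIneq`: `lineIter_one`, `sum_bond_eq`), p38's `Balaban1983to89.B4Thm19ZeroTorus` (→
`B4Thm110ZeroTorus`, pv07's `B1RG242Torus`, `B5Ineq137Torus.T`).  Literature + Mathlib only.
Unit `lit-balaban-p31` (literature-prover-lit-balaban-p31-g16-0), 2026-08-22.  NOT summit progress.
-/

open scoped BigOperators Matrix ComplexConjugate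
open Finset Matrix

namespace Literature.MathematicalPhysics.QuantumFieldTheory.BalabanImbrieJaffe1984to88.BIJ88NeumannPropagatorFlatDecay

open Literature.MathematicalPhysics.QuantumFieldTheory.Balaban1983to89
open BIJ88Sect3Statements (U1 toC cfg covD starB mem_starB toC_mul toC_one toC_inv norm_toC)
open BIJ85Sect1Model (HiggsField)
open BIJ85BlockAveragesTorus BIJ85BlockAveragesTorusK
open BIJ85BlockAveragingIneq (lineIter_one deltaAx_one sum_bond_eq)
open BIJ85BlockKPoincare (val_blkIter)
open BIJ88Vj5610Operator (dMat qMat chiN hMat)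
open BIJ88NeumannNoZeroModesTorus (IsBlockUnion isBlockUnion_univ)
open BIJ88NeumannPropagator227Torus
open BIJ88DeltaLoc234Torus (mulOp gBox_gaugeAct gBox_gaugeAct_apply)
open GaugeField (gaugeAct)

noncomputable section

variable {P : Params} {j : ℕ}

/-! ## §1 The flat background `u = 1`: transports, the `k`-level average, the Neumann-cut derivative on the whole torus -/

/-- kernel: the flat configuration read in `ℂ` is the constant `1`. [cite: BalabanImbrieJaffe1985, (2.5) p.302] -/
theorem cfg_flat (b : PBond P j) : cfg (1 : GaugeField P j U1) b = 1 := by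
  show toC 1 = 1
  exact toC_one

/-- **At the flat background every composite-contour transport `u(Γ^{(k)}_{x_k,x})` of [I] (5.1.2)–(5.1.3) is `1`** (p. 303 *"In the axial
gauge, Qφ reduces to the ordinary average"*: `1` is in axial gauge at every level, p11's `holCK_of_deltaAx`). [cite: BalabanImbrieJaffe1985, (2.6) p.303] -/
theorem holCK_flat {k : ℕ} (hk : j + k ≤ P.m + P.K) (x : Balaban1983to89.Site P j) : holCK (1 : GaugeField P j U1) k x = 1 :=
  holCK_of_deltaAx 1 k hk (fun i _ => by rw [lineIter_one i]; exact deltaAx_one) x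

/-- kernel: the entries of `Q_k(1)|_T` — `L^{−kd}` on the block of `y`, `0` elsewhere. [cite: BalabanImbrieJaffe1985, (4.6.1) p.313] -/
theorem qMatK_flat_apply {k : ℕ} (hk : j + k ≤ P.m + P.K) (y : Balaban1983to89.Site P (j+k)) (x : Balaban1983to89.Site P j) :
    qMatK (1 : GaugeField P j U1) k univ y x = if blkIter k x = y then (((P.L : ℂ) ^ (k * P.d))⁻¹) else 0 := by
  rw [qMatK_apply, holCK_flat hk, mul_one]
  by_cases h : blkIter k x = y
  · rw [if_pos h, if_pos ⟨subset_univ _, mem_blockK.2 h⟩]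
  · rw [if_neg h, if_neg (fun h' => h (mem_blockK.1 h'.2))]

/-- kernel: on the whole torus the Neumann cut-off keeps every bond: `(χ_TD_u)(b,x) = D_u(b,x) = c(u_b[x = b₊] − [x = b₋])`.
[cite: BalabanImbrieJaffe1988, (5.6.10) p.287] -/
theorem dN_univ_apply (c : ℝ) (U : GaugeField P j U1) (b : PBond P j) (x : Balaban1983to89.Site P j) :
    dN c U univ b x = (c : ℂ) * (if x = b.tgt then cfg U b else 0) - (c : ℂ) * (if x = b.src then 1 else 0) := by
  rw [dN_apply, if_pos ((mem_starB _ _).2 ⟨mem_univ _, mem_univ _⟩)]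
  rfl

/-! ## §2 The entrywise bridge to pv07's B1/B4 tower operator at `u = 1`, and `G_k(T,1) = (tower P a 0).G k` -/

/-- kernel: at `u = 1` the Neumann-cut derivative has the REAL entries `c([x = b₊] − [x = b₋])`. [cite: BalabanImbrieJaffe1988, (5.6.10) p.287] -/
theorem dN_flat_apply (c : ℝ) (b : PBond P j) (x : Balaban1983to89.Site P j) :
    dN c (1 : GaugeField P j U1) univ b x =
      ((c * ((if x = b.tgt then (1 : ℝ) else 0) - (if x = b.src then (1 : ℝ) else 0)) : ℝ) : ℂ) := by
  rw [dN_univ_apply, cfg_flat]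
  split_ifs <;> push_cast <;> ring

/-- kernel: **the Laplacian Gram matrix at `u = 1`**: `((χ_TD₁)ᴴ(χ_TD₁))(x,x′) = c²Σ_zΣ_μ([x = z+e_μ] − [x = z])([x′ = z+e_μ] − [x′ = z])`
(a real number). [cite: BalabanImbrieJaffe1988, (5.6.10) p.287] -/
theorem gram_dN_flat_apply (c : ℝ) (x x' : Balaban1983to89.Site P j) :
    ((dN c (1 : GaugeField P j U1) univ)ᴴ * dN c (1 : GaugeField P j U1) univ) x x' =
      ((c ^ 2 * ∑ z : Balaban1983to89.Site P j, ∑ μ : Fin P.d,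
        ((if x = z.shift μ then (1 : ℝ) else 0) - (if x = z then 1 else 0)) *
          ((if x' = z.shift μ then (1 : ℝ) else 0) - (if x' = z then 1 else 0)) : ℝ) : ℂ) := by
  rw [mul_apply]
  simp_rw [conjTranspose_apply, dN_flat_apply, Complex.star_def, Complex.conj_ofReal, ← Complex.ofReal_mul]
  rw [← Complex.ofReal_sum]
  congr 1
  rw [sum_bond_eq, mul_sum]
  refine sum_congr rfl fun z _ => ?_
  rw [mul_sum]
  refine sum_congr rfl fun μ _ => ?_
  show c * ((if x = z.shift μ then (1 : ℝ) else 0) - (if x = z then 1 else 0)) *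
      (c * ((if x' = z.shift μ then (1 : ℝ) else 0) - (if x' = z then 1 else 0))) = _
  ring

/-- kernel: **the block Gram matrix at `u = 1`**: `((Q_k|_T)ᴴ(Q_k|_T))(x,x′) = L^{−2kd}·[x_k = x′_k]` (same `k`-block; a real number).
[cite: BalabanImbrieJaffe1985, (4.6.1) p.313] -/
theorem gram_qMatK_flat_apply {k : ℕ} (hk : j + k ≤ P.m + P.K) (x x' : Balaban1983to89.Site P j) :
    ((qMatK (1 : GaugeField P j U1) k univ)ᴴ * qMatK (1 : GaugeField P j U1) k univ) x x' =
      ((if blkIter k x = blkIter k x' then ((((P.L : ℝ) ^ (k * P.d))⁻¹) ^ 2) else 0 : ℝ) : ℂ) := by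
  rw [mul_apply]
  simp_rw [conjTranspose_apply, qMatK_flat_apply hk]
  have key : ∀ y : Balaban1983to89.Site P (j+k),
      star (if blkIter k x = y then (((P.L : ℂ) ^ (k * P.d))⁻¹) else 0) * (if blkIter k x' = y then (((P.L : ℂ) ^ (k * P.d))⁻¹) else 0) =
        if blkIter k x = y then
          ((if blkIter k x = blkIter k x' then ((((P.L : ℝ) ^ (k * P.d))⁻¹) ^ 2) else 0 : ℝ) : ℂ) else 0 := by
    intro y
    by_cases h1 : blkIter k x = y
    · rw [if_pos h1, if_pos h1]
      by_cases h2 : blkIter k x' = y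
      · rw [if_pos h2, if_pos (h1.trans h2.symm)]
        have e : star (((P.L : ℂ) ^ (k * P.d))⁻¹) = (((P.L : ℂ) ^ (k * P.d))⁻¹) := by
          rw [Complex.star_def, map_inv₀, map_pow, Complex.conj_natCast]
        rw [e]
        push_cast
        ring
      · rw [if_neg h2, if_neg (fun h => h2 (h.symm.trans h1)), mul_zero, Complex.ofReal_zero]
    · rw [if_neg h1, star_zero, zero_mul, if_neg h1]
  simp_rw [key]
  rw [sum_ite_eq, if_pos (mem_univ _)]

/-- **The two block relations agree**: p11's `k`-fold block points `x_k` ([I] (5.1.2)) of `x, x′ ∈ T^{(0)}` coincide iff pv07's `k`-fold block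
labels `⌊x/L^k⌋` ([B1] (1.17)/(1.20)) do — both are integer division of the labels by `L^k` (p33's `val_blkIter`, pv07's `Site.val_proj`).
[cite: BalabanImbrieJaffe1985, (5.1.2)–(5.1.3) p.313] -/
theorem blkIter_eq_iff_proj_eq {k : ℕ} (hk : k ≤ P.m + P.K) (x x' : Balaban1983to89.Site P 0) :
    blkIter k x = blkIter k x' ↔
      Balaban1983to89.Site.proj k (B1RG242Torus.lvl P k) x = Balaban1983to89.Site.proj k (B1RG242Torus.lvl P k) x' := by
  have hk0 : 0 + k ≤ P.m + P.K := by omega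
  have hs : P.sitesPerDir 0 = P.L ^ B1RG242Torus.lvl P k * P.sitesPerDir k := B1RG242Torus.sitesPerDir_zero_eq P k
  have hl : B1RG242Torus.lvl P k = k := B1RG242Torus.lvl_of_le P hk
  constructor
  · intro h
    funext μ
    apply ZMod.val_injective
    rw [Balaban1983to89.Site.val_proj hs, Balaban1983to89.Site.val_proj hs, hl, ← val_blkIter k hk0 x μ, ← val_blkIter k hk0 x' μ, h]
  · intro h
    funext μ
    apply ZMod.val_injective
    have hμ : ((Balaban1983to89.Site.proj k (B1RG242Torus.lvl P k) x) μ).val =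
        ((Balaban1983to89.Site.proj k (B1RG242Torus.lvl P k) x') μ).val := by rw [h]
    rw [Balaban1983to89.Site.val_proj hs, Balaban1983to89.Site.val_proj hs, hl] at hμ
    rw [val_blkIter k hk0 x μ, val_blkIter k hk0 x' μ, hμ]

/-- kernel: **pv07's Laplacian `Σ_μ ∂_μᵀ∂_μ` entrywise**: `ε^{−2}Σ_zΣ_μ([x = z+e_μ] − [x = z])([x′ = z+e_μ] − [x′ = z])`.
[cite: Balaban1982Higgs1, (1.11) p.605] -/
theorem towerLap_apply (x x' : Balaban1983to89.Site P 0) :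
    (∑ μ : Fin P.d, (B1RG242Torus.deriv P 0 P.eps μ)ᵀ * B1RG242Torus.deriv P 0 P.eps μ) x x' =
      (P.eps⁻¹) ^ 2 * ∑ z : Balaban1983to89.Site P 0, ∑ μ : Fin P.d,
        ((if x = z.shift μ then (1 : ℝ) else 0) - (if x = z then 1 else 0)) *
          ((if x' = z.shift μ then (1 : ℝ) else 0) - (if x' = z then 1 else 0)) := by
  rw [Matrix.sum_apply]
  simp_rw [mul_apply, transpose_apply]
  rw [sum_comm, mul_sum]
  refine sum_congr rfl fun z _ => ?_
  rw [mul_sum]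
  refine sum_congr rfl fun μ _ => ?_
  simp only [B1RG242Torus.deriv, B1RG242Torus.shiftMat, Matrix.smul_apply, Matrix.sub_apply, Matrix.one_apply, smul_eq_mul]
  have e1 : (if z = x then (1 : ℝ) else 0) = (if x = z then 1 else 0) := if_congr eq_comm rfl rfl
  have e2 : (if z = x' then (1 : ℝ) else 0) = (if x' = z then 1 else 0) := if_congr eq_comm rfl rfl
  rw [e1, e2]
  ring

/-- kernel: **pv07's `Q_k^*Q_k` entrywise**: `(L^{−d})^{lvl k}·[⌊x/L^k⌋ = ⌊x′/L^k⌋]`. [cite: Balaban1982Higgs1, (2.11) p.609] -/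
theorem towerQ_apply (k : ℕ) (x x' : Balaban1983to89.Site P 0) :
    (B1RG242Torus.Qks P k * B1RG242Torus.Qk P k) x x' =
      if Balaban1983to89.Site.proj k (B1RG242Torus.lvl P k) x = Balaban1983to89.Site.proj k (B1RG242Torus.lvl P k) x'
      then (((P.L : ℝ) ^ P.d)⁻¹) ^ B1RG242Torus.lvl P k else 0 := by
  rw [mul_apply]
  have key : ∀ y : Balaban1983to89.Site P k, B1RG242Torus.Qks P k x y * B1RG242Torus.Qk P k y x' =
      if Balaban1983to89.Site.proj k (B1RG242Torus.lvl P k) x = y then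
        (if Balaban1983to89.Site.proj k (B1RG242Torus.lvl P k) x = Balaban1983to89.Site.proj k (B1RG242Torus.lvl P k) x'
          then (((P.L : ℝ) ^ P.d)⁻¹) ^ B1RG242Torus.lvl P k else 0) else 0 := by
    intro y
    simp only [B1RG242Torus.Qks, B1RG242Torus.Qk, B1RG242Torus.extMat, B1RG242Torus.avgMat]
    by_cases h1 : Balaban1983to89.Site.proj k (B1RG242Torus.lvl P k) x = y
    · rw [if_pos h1, if_pos h1, one_mul]
      by_cases h2 : Balaban1983to89.Site.proj k (B1RG242Torus.lvl P k) x' = y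
      · rw [if_pos h2, if_pos (h1.trans h2.symm)]
      · rw [if_neg h2, if_neg (fun h => h2 (h.symm.trans h1))]
    · rw [if_neg h1, zero_mul, if_neg h1]
  simp_rw [key]
  rw [sum_ite_eq, if_pos (mem_univ _)]

/-- kernel: the two normalizations of the block weight agree: `α_kL^{kd}·(L^{−kd})² = α_k·(L^{−d})^k`. [folklore] -/
private theorem weight_identity (α : ℝ) (k : ℕ) (hL : (P.L : ℝ) ≠ 0) :
    α * (P.L : ℝ) ^ (k * P.d) * ((((P.L : ℝ) ^ (k * P.d))⁻¹) ^ 2) = α * ((((P.L : ℝ) ^ P.d)⁻¹) ^ k) := by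
  have hp : (P.L : ℝ) ^ (k * P.d) ≠ 0 := pow_ne_zero _ hL
  have h1 : (((P.L : ℝ) ^ P.d)⁻¹) ^ k = ((P.L : ℝ) ^ (k * P.d))⁻¹ := by
    rw [inv_pow, ← pow_mul, Nat.mul_comm P.d k]
  rw [h1, sq]
  field_simp

/-- kernel: **the entries of the gen-15 Neumann operator at `u = 1` equal those of pv07's tower operator** (real numbers), at the matching
parameters. [cite: BalabanImbrieJaffe1985, (4.6.2) p.313] -/
theorem nOp_flat_apply (a : ℝ) {k : ℕ} (hk : k ≤ P.m + P.K) (x x' : Balaban1983to89.Site P 0) :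
    nOp (B1RG242Torus.α P a k * (P.L : ℝ) ^ (k * P.d)) P.eps⁻¹ (1 : GaugeField P 0 U1) k univ x x' =
      (((B1RG242Torus.H P 0 + B1RG242Torus.α P a k • (B1RG242Torus.Qks P k * B1RG242Torus.Qk P k)) x x' : ℝ) : ℂ) := by
  have hk0 : 0 + k ≤ P.m + P.K := by omega
  have hL : (P.L : ℝ) ≠ 0 := P.cast_L_pos.ne'
  rw [nOp_eq, Matrix.add_apply, Matrix.smul_apply, gram_dN_flat_apply, gram_qMatK_flat_apply hk0, smul_eq_mul, ← Complex.ofReal_mul,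
    ← Complex.ofReal_add]
  congr 1
  rw [B1RG242Torus.H, B1RG242Torus.hOp, zero_smul,
    zero_add (∑ μ : Fin P.d, (B1RG242Torus.deriv P 0 P.eps μ)ᵀ * B1RG242Torus.deriv P 0 P.eps μ), Matrix.add_apply, Matrix.smul_apply,
    towerLap_apply, towerQ_apply, smul_eq_mul]
  by_cases hB : blkIter k x = blkIter k x'
  · rw [if_pos hB, if_pos ((blkIter_eq_iff_proj_eq hk x x').1 hB), B1RG242Torus.lvl_of_le P hk, weight_identity _ k hL]
  · rw [if_neg hB, if_neg (fun h => hB ((blkIter_eq_iff_proj_eq hk x x').2 h)), mul_zero, mul_zero]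

/-- **THE OPERATOR BRIDGE AT `u = 1`**: in the normalization `c = ε⁻¹`, `Q_k^*Q_k`-coefficient `α_kL^{kd}` (`α_k = a_k(L^kε)^{−2}`, pv07's
`B1RG242Torus.α`), the Neumann operator of the whole torus `−Δ^N_{1,T} + (α_kL^{kd})Q_k(1)ᴴQ_k(1)` of gen 15 IS pv07's B1/B4 tower operator
`−Δ^ε + α_kQ_k^*Q_k` ([B1] (2.20), [6] (1.6) at `A = 0`, `m² = 0`) read in `ℂ` — the two formalizations of [I] (4.6.2) at the flat background
agree entry by entry. [cite: BalabanImbrieJaffe1985, (4.6.2) p.313] -/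
theorem nOp_flat_eq_tower (a : ℝ) {k : ℕ} (hk : k ≤ P.m + P.K) :
    nOp (B1RG242Torus.α P a k * (P.L : ℝ) ^ (k * P.d)) P.eps⁻¹ (1 : GaugeField P 0 U1) k univ =
      (B1RG242Torus.H P 0 + B1RG242Torus.α P a k • (B1RG242Torus.Qks P k * B1RG242Torus.Qk P k)).map Complex.ofRealHom := by
  ext x x'
  rw [nOp_flat_apply a hk, map_apply, Complex.ofRealHom_eq_coe]

/-- kernel: `1_T = 1` (the whole torus projects by the identity). [cite: BalabanImbrieJaffe1988, (2.27) p.263] -/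
theorem proj_univ : proj (univ : Finset (Balaban1983to89.Site P j)) = 1 := by
  unfold proj; rw [← diagonal_one]; congr 1; funext x; simp

/-- **`G_k(T_η, 1) = [6]'s `G_k(T_η, 0)`**: the gen-15 whole-torus propagator at the flat background (parameters as in `nOp_flat_eq_tower`)
is pv07's tower inverse `(tower P a 0).G k = (−Δ^ε + α_kQ_k^*Q_k)^{−1}` read in `ℂ` — by the uniqueness of the inverse on `ℓ²(T)` (gen 15
`eq_gBox_of_right_inverse`; invertibility pv07 `B1RG242Torus.G_arg`). [cite: BalabanImbrieJaffe1988, (2.27) p.263] -/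
theorem gBox_flat_eq_tower {a : ℝ} (ha : 0 < a) {k : ℕ} (hk1 : 1 ≤ k) (hk : k ≤ P.m + P.K) :
    gBox (B1RG242Torus.α P a k * (P.L : ℝ) ^ (k * P.d)) P.eps⁻¹ (1 : GaugeField P 0 U1) k univ =
      ((B1RG242Torus.tower P a 0).G k).map Complex.ofRealHom := by
  have hk0 : 0 + k ≤ P.m + P.K := by omega
  have hα : 0 < B1RG242Torus.α P a k :=
    mul_pos (B1.aSeq_pos ha (B1RG242Torus.one_lt_cast_L P) hk1) (inv_pos.mpr (pow_pos (P.spacing_pos k) 2))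
  have ha' : 0 < B1RG242Torus.α P a k * (P.L : ℝ) ^ (k * P.d) := mul_pos hα (pow_pos P.cast_L_pos _)
  have hc : P.eps⁻¹ ≠ 0 := inv_ne_zero P.eps_pos.ne'
  have hN := isUnit_nPad hk0 hc ha' (1 : GaugeField P 0 U1) (isBlockUnion_univ k)
  have hT : IsUnit (B1RG242Torus.H P 0 + B1RG242Torus.α P a k • (B1RG242Torus.Qks P k * B1RG242Torus.Qk P k)) :=
    B1RG242Torus.G_arg (P := P) ha le_rfl k hk1
  have hdet := (isUnit_iff_isUnit_det _).1 hT
  symm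
  refine eq_gBox_of_right_inverse hN ?_ ?_
  · rw [nOp_flat_eq_tower a hk, proj_univ]
    show _ * ((B1RG242Torus.H P 0 + B1RG242Torus.α P a k • (B1RG242Torus.Qks P k * B1RG242Torus.Qk P k))⁻¹).map Complex.ofRealHom = 1
    rw [← Matrix.map_mul, mul_nonsing_inv _ hdet, Matrix.map_one _ (map_zero _) (map_one _)]
  · rw [proj_univ, Matrix.one_mul]

/-- kernel: **the entries of `G_k(T,1)` are the real numbers `(tower P a 0).G k x y`**. [cite: BalabanImbrieJaffe1988, (2.27) p.263] -/
theorem gBox_flat_apply {a : ℝ} (ha : 0 < a) {k : ℕ} (hk1 : 1 ≤ k) (hk : k ≤ P.m + P.K) (x y : Balaban1983to89.Site P 0) :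
    gBox (B1RG242Torus.α P a k * (P.L : ℝ) ^ (k * P.d)) P.eps⁻¹ (1 : GaugeField P 0 U1) k univ x y =
      (((B1RG242Torus.tower P a 0).G k x y : ℝ) : ℂ) := by
  rw [gBox_flat_eq_tower ha hk1 hk, map_apply, Complex.ofRealHom_eq_coe]

/-- **The BIJ88 reading (unit block lattice, `k = K`, `L^Kε = 1`)**: the tower coefficient `α_K = a_K(L^Kε)^{−2}` IS the running
coefficient `a_K = a(1 − L^{−2})/(1 − L^{−2K})` of [I] (2.16) (the tree's `B1.aSeq`), so at `k = K` the `Q_Kᴴ Q_K`-coefficient of the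
bridge is `a_K·L^{Kd} = a_K·η^{−d}`, `η = ε = L^{−K}` — the printed operator `−Δ^η_u + a_KQ_K^*(u)Q_K(u)` of (4.6.2) in the counting-measure
normalization of gen 15. [cite: BalabanImbrieJaffe1985, (4.6.2) p.313] -/
theorem alpha_top (P : Params) (a : ℝ) : B1RG242Torus.α P a P.K = B1.aSeq a P.L P.K := by
  rw [B1RG242Torus.α, P.spacing_K, one_pow, inv_one, mul_one]

/-! ## §3 Pure-gauge backgrounds `u = 1^h`: gauge covariance of `G_k(T,·)`, the rotated source `h̄f`, real and imaginary parts -/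

section PureGauge

variable {a : ℝ} {k : ℕ}

/-- **`G_k(T, 1^h) = M_h·G_k(T_η, 0)·M_hᴴ`** — the torus propagator of record at the pure-gauge background `u_b = h(b₋)h(b₊)^{−1}` is the
zero-field tower inverse conjugated by the phases (gen 15's `gBox_gaugeAct` = [I] (6.3.2), and §2). [cite: BalabanImbrieJaffe1985, (6.3.2) p.320] -/
theorem gBox_pureGauge (ha : 0 < a) (hk1 : 1 ≤ k) (hk : k ≤ P.m + P.K) (h : GaugeTransf P 0 U1) :
    gBox (B1RG242Torus.α P a k * (P.L : ℝ) ^ (k * P.d)) P.eps⁻¹ (gaugeAct h (1 : GaugeField P 0 U1)) k univ =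
      mulOp h * ((B1RG242Torus.tower P a 0).G k).map Complex.ofRealHom * (mulOp h)ᴴ := by
  have hk0 : 0 + k ≤ P.m + P.K := by omega
  have hα : 0 < B1RG242Torus.α P a k :=
    mul_pos (B1.aSeq_pos ha (B1RG242Torus.one_lt_cast_L P) hk1) (inv_pos.mpr (pow_pos (P.spacing_pos k) 2))
  have ha' : 0 < B1RG242Torus.α P a k * (P.L : ℝ) ^ (k * P.d) := mul_pos hα (pow_pos P.cast_L_pos _)
  rw [gBox_gaugeAct hk0 (inv_ne_zero P.eps_pos.ne') ha' h 1 (isBlockUnion_univ k), gBox_flat_eq_tower ha hk1 hk]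

/-- kernel: `M_hᴴf = h̄f` — the source rotated by the conjugate phases. [cite: BalabanImbrieJaffe1985, (2.7) p.303] -/
theorem mulOp_conjTranspose_mulVec (h : GaugeTransf P j U1) (f : Balaban1983to89.Site P j → ℂ) :
    (mulOp h)ᴴ *ᵥ f = fun y => (starRingEnd ℂ) (toC (h y)) * f y := by
  funext y
  rw [mulOp, diagonal_conjTranspose, mulVec_diagonal, Pi.star_apply, Complex.star_def]

/-- kernel: `(M_hv)(x) = h(x)v(x)`. [cite: BalabanImbrieJaffe1985, (2.7) p.303] -/
theorem mulOp_mulVec (h : GaugeTransf P j U1) (v : Balaban1983to89.Site P j → ℂ) (x : Balaban1983to89.Site P j) :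
    (mulOp h *ᵥ v) x = toC (h x) * v x := by
  rw [mulOp, mulVec_diagonal]

/-- **`(G_k(T,1^h)f)(x) = h(x)·(G_k(T_η,0)(h̄f))(x)`**. [cite: BalabanImbrieJaffe1985, (6.3.2) p.320] -/
theorem gBox_pureGauge_mulVec (ha : 0 < a) (hk1 : 1 ≤ k) (hk : k ≤ P.m + P.K) (h : GaugeTransf P 0 U1) (f : Balaban1983to89.Site P 0 → ℂ)
    (x : Balaban1983to89.Site P 0) :
    (gBox (B1RG242Torus.α P a k * (P.L : ℝ) ^ (k * P.d)) P.eps⁻¹ (gaugeAct h (1 : GaugeField P 0 U1)) k univ *ᵥ f) x =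
      toC (h x) * (((B1RG242Torus.tower P a 0).G k).map Complex.ofRealHom *ᵥ fun y => (starRingEnd ℂ) (toC (h y)) * f y) x := by
  rw [gBox_pureGauge ha hk1 hk h, ← mulVec_mulVec, ← mulVec_mulVec, mulOp_conjTranspose_mulVec, mulOp_mulVec]

/-- kernel: the real part of a real matrix applied to a complex vector is the matrix applied to the real part. [folklore] -/
private theorem re_map_mulVec {m n : Type*} [Fintype n] (G : Matrix m n ℝ) (g : n → ℂ) (x : m) :
    ((G.map Complex.ofRealHom *ᵥ g) x).re = (G *ᵥ fun y => (g y).re) x := by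
  simp only [mulVec, dotProduct, map_apply, Complex.ofRealHom_eq_coe, Complex.re_sum, Complex.re_ofReal_mul]

/-- kernel: the same for the imaginary part. [folklore] -/
private theorem im_map_mulVec {m n : Type*} [Fintype n] (G : Matrix m n ℝ) (g : n → ℂ) (x : m) :
    ((G.map Complex.ofRealHom *ᵥ g) x).im = (G *ᵥ fun y => (g y).im) x := by
  simp only [mulVec, dotProduct, map_apply, Complex.ofRealHom_eq_coe, Complex.im_sum, Complex.im_ofReal_mul]

/-- kernel: `‖(G g)(x)‖ ≤ |(G Re g)(x)| + |(G Im g)(x)|` for a real matrix `G`. [folklore] -/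
private theorem norm_map_mulVec_le {m n : Type*} [Fintype n] (G : Matrix m n ℝ) (g : n → ℂ) (x : m) :
    ‖(G.map Complex.ofRealHom *ᵥ g) x‖ ≤ |(G *ᵥ fun y => (g y).re) x| + |(G *ᵥ fun y => (g y).im) x| := by
  rw [← re_map_mulVec, ← im_map_mulVec]
  exact Complex.norm_le_abs_re_add_abs_im _

/-- kernel: a difference version — `‖ψ₂ − ψ₁‖ ≤ |Re ψ₂ − Re ψ₁| + |Im ψ₂ − Im ψ₁|` with `ψ = c·((G g)(y) − (G g)(x))` read through the real
and imaginary parts. [folklore] -/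
private theorem norm_sub_le_re_im (z w : ℂ) : ‖z - w‖ ≤ |z.re - w.re| + |z.im - w.im| := by
  have h := Complex.norm_le_abs_re_add_abs_im (z - w)
  rwa [Complex.sub_re, Complex.sub_im] at h

/-- kernel: the rotated source `h̄f` has the same size as `f` pointwise. [cite: BalabanImbrieJaffe1985, (2.7) p.303] -/
theorem norm_rot (h : GaugeTransf P j U1) (f : Balaban1983to89.Site P j → ℂ) (y : Balaban1983to89.Site P j) :
    ‖(starRingEnd ℂ) (toC (h y)) * f y‖ = ‖f y‖ := by
  rw [norm_mul, Complex.norm_conj, norm_toC, one_mul]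

/-- kernel: the rotated source has the same support as `f`. [cite: BalabanImbrieJaffe1985, (2.7) p.303] -/
theorem rot_ne_zero_iff (h : GaugeTransf P j U1) (f : Balaban1983to89.Site P j → ℂ) (y : Balaban1983to89.Site P j) :
    (starRingEnd ℂ) (toC (h y)) * f y ≠ 0 ↔ f y ≠ 0 := by
  rw [← norm_ne_zero_iff, norm_rot, norm_ne_zero_iff]

/-- **The covariant derivative of `G_k(T,1^h)f` at the pure-gauge background**: with `u = 1^h` and `ψ = G_k(T_η,0)(h̄f)`,
`ε⁻¹(u_b(G f)(b₊) − (G f)(b₋)) = h(b₋)·ε⁻¹(ψ(b₊) − ψ(b₋))` — the printed `D^η_{A,μ}G_k f` at `A` gauge-equivalent to `0`.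
[cite: BalabanImbrieJaffe1985, (6.3.2) p.320] -/
theorem covD_gBox_pureGauge (ha : 0 < a) (hk1 : 1 ≤ k) (hk : k ≤ P.m + P.K) (h : GaugeTransf P 0 U1) (f : Balaban1983to89.Site P 0 → ℂ)
    (b : PBond P 0) :
    covD P.eps⁻¹ (cfg (gaugeAct h (1 : GaugeField P 0 U1)))
        (gBox (B1RG242Torus.α P a k * (P.L : ℝ) ^ (k * P.d)) P.eps⁻¹ (gaugeAct h (1 : GaugeField P 0 U1)) k univ *ᵥ f) b =
      toC (h b.src) * (((P.eps⁻¹ : ℝ) : ℂ) *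
        ((((B1RG242Torus.tower P a 0).G k).map Complex.ofRealHom *ᵥ fun y => (starRingEnd ℂ) (toC (h y)) * f y) b.tgt -
          (((B1RG242Torus.tower P a 0).G k).map Complex.ofRealHom *ᵥ fun y => (starRingEnd ℂ) (toC (h y)) * f y) b.src)) := by
  rw [covD, gBox_pureGauge_mulVec ha hk1 hk, gBox_pureGauge_mulVec ha hk1 hk]
  have hu : cfg (gaugeAct h (1 : GaugeField P 0 U1)) b = toC (h b.src) * (toC (h b.tgt))⁻¹ := by
    show toC (gaugeAct h 1 b) = _
    rw [toC_gaugeAct]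
    show toC (h b.src) * toC 1 * (toC (h b.tgt))⁻¹ = _
    rw [toC_one, mul_one]
  rw [hu]
  have ht : toC (h b.tgt) ≠ 0 := toC_ne_zero _
  field_simp

end PureGauge

/-! ## §4 [6]'s Theorem (1.10)/(1.9) for `G_k(T_η, 1^h)` — hypothesis-free, constants from `(d, L, a)` -/

/-- **[6] (1.10) FOR THE TORUS PROPAGATOR OF RECORD AT EVERY PURE-GAUGE BACKGROUND** (*"|(D^η_{A,μ}G_k(Ω, A)f)(x)|, |(G_k(Ω, A)f)(x)| ≤
c₀exp(−δ₀ dist(x, supp f))‖f‖_∞ (1.10) … for rectangular parallelepipeds, the inequalities hold without any restrictions on the points"*;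
C2 (2.30) *"a straightforward application of the random walk expansion of [6]"*; [I] p. 326 *"The propagators arising from Δ_k(u_k) … also
satisfy the regularity and decay estimates of [7] … by change of gauge u_k can be transformed … into a configuration of the form
exp[ie_kηA]"*, here `A = 0`): there are `δ₀, c₀ > 0` depending on `(d, L, a)` only such that on EVERY torus of the series with these `d, L`,
for every level `1 ≤ k ≤ K`, every gauge function `h : T^{(0)} → U(1)`, every site `x` and every complex source `f` with `‖f‖_∞ ≤ F`
supported at sup-torus distance `≥ D` (lattice units; `εD` printed units) from `x`: the VALUE member `‖(G_k(T,1^h)f)(x)‖ ≤ c₀e^{−δ₀εD}F` and,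
for every direction `μ`, the COVARIANT-DERIVATIVE member `‖ε⁻¹(u_{⟨x,x+e_μ⟩}(G f)(x+e_μ) − (G f)(x))‖ ≤ c₀e^{−δ₀εD}F`, `u = 1^h`,
`G = gBox (α_kL^{kd}) ε⁻¹ u k T` — from p38's zero-field torus theorem `B4Thm110ZeroTorus.thm110_zero_torus` on the real and imaginary parts of
`h̄f`. [cite: Balaban1983RegularityDecay, (1.10) p.573] -/
theorem decay110_flat (d L : ℕ) (hd : 1 ≤ d) (hL : Odd L ∧ 1 < L) {a : ℝ} (ha : 0 < a) :
    ∃ δ₀ c₀ : ℝ, 0 < δ₀ ∧ 0 < c₀ ∧ ∀ (P : Params), P.d = d → P.L = L →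
      ∀ k : ℕ, 1 ≤ k → k ≤ P.K → ∀ (h : GaugeTransf P 0 U1) (x : Balaban1983to89.Site P 0) (f : Balaban1983to89.Site P 0 → ℂ) (F D : ℝ),
        (∀ z, ‖f z‖ ≤ F) → 0 ≤ D → (∀ z, f z ≠ 0 → D ≤ B5Ineq137Torus.T P 0 x z) →
          ‖(gBox (B1RG242Torus.α P a k * (P.L : ℝ) ^ (k * P.d)) P.eps⁻¹ (gaugeAct h (1 : GaugeField P 0 U1)) k univ *ᵥ f) x‖
              ≤ c₀ * Real.exp (-(δ₀ * (P.eps * D))) * F ∧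
          ∀ μ : Fin P.d,
            ‖covD P.eps⁻¹ (cfg (gaugeAct h (1 : GaugeField P 0 U1)))
                (gBox (B1RG242Torus.α P a k * (P.L : ℝ) ^ (k * P.d)) P.eps⁻¹ (gaugeAct h (1 : GaugeField P 0 U1)) k univ *ᵥ f) ⟨x, μ⟩‖
              ≤ c₀ * Real.exp (-(δ₀ * (P.eps * D))) * F := by
  obtain ⟨δ₀, c₀, hδ₀, hc₀, H⟩ := B4Thm110ZeroTorus.thm110_zero_torus d L hd hL ha (le_refl (0 : ℝ))
  refine ⟨δ₀, 2 * c₀, hδ₀, by positivity, ?_⟩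
  intro P hPd hPL k hk1 hkK h x f F D hF hD hsupp
  have hk : k ≤ P.m + P.K := hkK.trans (Nat.le_add_left _ _)
  set g : Balaban1983to89.Site P 0 → ℂ := fun y => (starRingEnd ℂ) (toC (h y)) * f y with hg
  have hgR : ∀ z, |(g z).re| ≤ F := fun z => ((Complex.abs_re_le_norm _).trans_eq (norm_rot h f z)).trans (hF z)
  have hgI : ∀ z, |(g z).im| ≤ F := fun z => ((Complex.abs_im_le_norm _).trans_eq (norm_rot h f z)).trans (hF z)
  have hsR : ∀ z, (g z).re ≠ 0 → D ≤ B5Ineq137Torus.T P 0 x z := fun z hz =>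
    hsupp z fun hf => hz (by simp only [hg, hf, mul_zero, Complex.zero_re])
  have hsI : ∀ z, (g z).im ≠ 0 → D ≤ B5Ineq137Torus.T P 0 x z := fun z hz =>
    hsupp z fun hf => hz (by simp only [hg, hf, mul_zero, Complex.zero_im])
  obtain ⟨HR, HRd⟩ := H P hPd hPL k hk1 hkK x (fun y => (g y).re) F D hgR hD hsR
  obtain ⟨HI, HId⟩ := H P hPd hPL k hk1 hkK x (fun y => (g y).im) F D hgI hD hsI
  set E : ℝ := c₀ * Real.exp (-(δ₀ * (P.eps * D))) * F with hE
  have hE2 : 2 * c₀ * Real.exp (-(δ₀ * (P.eps * D))) * F = E + E := by rw [hE]; ring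
  refine ⟨?_, fun μ => ?_⟩
  · rw [gBox_pureGauge_mulVec ha hk1 hk, norm_mul, norm_toC, one_mul, hE2]
    exact (norm_map_mulVec_le _ g x).trans (add_le_add HR HI)
  · rw [covD_gBox_pureGauge ha hk1 hk, norm_mul, norm_toC, one_mul, hE2]
    have hre : ((((P.eps⁻¹ : ℝ) : ℂ) *
        ((((B1RG242Torus.tower P a 0).G k).map Complex.ofRealHom *ᵥ g) (⟨x, μ⟩ : PBond P 0).tgt -
          (((B1RG242Torus.tower P a 0).G k).map Complex.ofRealHom *ᵥ g) (⟨x, μ⟩ : PBond P 0).src))).re =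
        ((B1RG242Torus.deriv P 0 P.eps μ * (B1RG242Torus.tower P a 0).G k) *ᵥ fun y => (g y).re) x := by
      rw [← mulVec_mulVec, B1RG242Torus.deriv_mulVec, Complex.re_ofReal_mul, Complex.sub_re, re_map_mulVec, re_map_mulVec]
      rfl
    have him : ((((P.eps⁻¹ : ℝ) : ℂ) *
        ((((B1RG242Torus.tower P a 0).G k).map Complex.ofRealHom *ᵥ g) (⟨x, μ⟩ : PBond P 0).tgt -
          (((B1RG242Torus.tower P a 0).G k).map Complex.ofRealHom *ᵥ g) (⟨x, μ⟩ : PBond P 0).src))).im =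
        ((B1RG242Torus.deriv P 0 P.eps μ * (B1RG242Torus.tower P a 0).G k) *ᵥ fun y => (g y).im) x := by
      rw [← mulVec_mulVec, B1RG242Torus.deriv_mulVec, Complex.im_ofReal_mul, Complex.sub_im, im_map_mulVec, im_map_mulVec]
      rfl
    refine (Complex.norm_le_abs_re_add_abs_im _).trans ?_
    rw [hre, him]
    exact add_le_add (HRd μ) (HId μ)

/-- **(1.10), KERNEL FORM**: `‖G_k(T, 1^h; x, y)‖ ≤ c₀e^{−δ₀ε|x−y|_T}` for all sites `x, y` (the source `δ_y`). [cite: Balaban1983RegularityDecay, (1.10) p.573] -/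
theorem decay110_flat_kernel (d L : ℕ) (hd : 1 ≤ d) (hL : Odd L ∧ 1 < L) {a : ℝ} (ha : 0 < a) :
    ∃ δ₀ c₀ : ℝ, 0 < δ₀ ∧ 0 < c₀ ∧ ∀ (P : Params), P.d = d → P.L = L →
      ∀ k : ℕ, 1 ≤ k → k ≤ P.K → ∀ (h : GaugeTransf P 0 U1) (x y : Balaban1983to89.Site P 0),
        ‖gBox (B1RG242Torus.α P a k * (P.L : ℝ) ^ (k * P.d)) P.eps⁻¹ (gaugeAct h (1 : GaugeField P 0 U1)) k univ x y‖
          ≤ c₀ * Real.exp (-(δ₀ * (P.eps * B5Ineq137Torus.T P 0 x y))) := by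
  obtain ⟨δ₀, c₀, hδ₀, hc₀, H⟩ := decay110_flat d L hd hL ha
  refine ⟨δ₀, c₀, hδ₀, hc₀, fun P hPd hPL k hk1 hkK h x y => ?_⟩
  have h1 := (H P hPd hPL k hk1 hkK h x (Pi.single y 1) 1 (B5Ineq137Torus.T P 0 x y)
    (fun z => by by_cases hz : z = y <;> simp [hz]) (B5Ineq137Torus.T_nonneg P 0 x y)
    (fun z hz => by
      by_cases hzy : z = y
      · rw [hzy]
      · exact absurd (by simp [hzy]) hz)).1
  rwa [mulVec_single_one, col_apply, mul_one] at h1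

/-- **[6] (1.9) FOR THE TORUS PROPAGATOR OF RECORD AT EVERY PURE-GAUGE BACKGROUND** — the Hölder member: there is `δ₀ > 0` and for every
`0 ≤ α < 1` a `c₀ > 0` (from `(d, L, a, α)`) such that, for all data as in `decay110_flat` and all pairs of sites `x₁ ≠ x₂` both at
sup-torus distance `≥ D` from `supp f`, `(ε|x₁−x₂|_T)^{−α}‖u(Γ_{x₁x₂})(D_uG f)(x₂,μ) − (D_uG f)(x₁,μ)‖ ≤ c₀e^{−δ₀εD}F`, where at the
pure-gauge background `u = 1^h` the parallel transport along ANY contour from `x₂` to `x₁` is `u(Γ_{x₁x₂}) = h(x₁)h(x₂)^{−1}` (written out) and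
`(D_uG f)(x,μ) = ε⁻¹(u_{⟨x,x+e_μ⟩}(G f)(x+e_μ) − (G f)(x))` — from p38's `B4Thm19ZeroTorus.thm19_zero_torus` on the real and imaginary parts
of `h̄f`. [cite: Balaban1983RegularityDecay, (1.9) p.573] -/
theorem holder19_flat (d L : ℕ) (hd : 1 ≤ d) (hL : Odd L ∧ 1 < L) {a : ℝ} (ha : 0 < a) :
    ∃ δ₀ : ℝ, 0 < δ₀ ∧ ∀ {α : ℝ}, 0 ≤ α → α < 1 → ∃ c₀ : ℝ, 0 < c₀ ∧ ∀ (P : Params), P.d = d → P.L = L →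
      ∀ k : ℕ, 1 ≤ k → k ≤ P.K → ∀ (h : GaugeTransf P 0 U1) (μ : Fin P.d) (x₁ x₂ : Balaban1983to89.Site P 0), x₂ ≠ x₁ →
        ∀ (f : Balaban1983to89.Site P 0 → ℂ) (F D : ℝ), (∀ z, ‖f z‖ ≤ F) → 0 ≤ D →
          (∀ z, f z ≠ 0 → D ≤ B5Ineq137Torus.T P 0 x₁ z) → (∀ z, f z ≠ 0 → D ≤ B5Ineq137Torus.T P 0 x₂ z) →
            ((P.eps * B5Ineq137Torus.T P 0 x₁ x₂)⁻¹) ^ α *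
              ‖toC (h x₁) * (toC (h x₂))⁻¹ *
                  covD P.eps⁻¹ (cfg (gaugeAct h (1 : GaugeField P 0 U1)))
                    (gBox (B1RG242Torus.α P a k * (P.L : ℝ) ^ (k * P.d)) P.eps⁻¹ (gaugeAct h (1 : GaugeField P 0 U1)) k univ *ᵥ f) ⟨x₂, μ⟩ -
                covD P.eps⁻¹ (cfg (gaugeAct h (1 : GaugeField P 0 U1)))
                    (gBox (B1RG242Torus.α P a k * (P.L : ℝ) ^ (k * P.d)) P.eps⁻¹ (gaugeAct h (1 : GaugeField P 0 U1)) k univ *ᵥ f) ⟨x₁, μ⟩‖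
              ≤ c₀ * Real.exp (-(δ₀ * (P.eps * D))) * F := by
  obtain ⟨δ₀, hδ₀, H⟩ := B4Thm19ZeroTorus.thm19_zero_torus d L hd hL ha (le_refl (0 : ℝ))
  refine ⟨δ₀, hδ₀, fun {α} hα0 hα1 => ?_⟩
  obtain ⟨c₀, hc₀, Hα⟩ := H hα0 hα1
  refine ⟨2 * c₀, by positivity, ?_⟩
  intro P hPd hPL k hk1 hkK h μ x₁ x₂ hx f F D hF hD hs₁ hs₂
  have hk : k ≤ P.m + P.K := hkK.trans (Nat.le_add_left _ _)
  set g : Balaban1983to89.Site P 0 → ℂ := fun y => (starRingEnd ℂ) (toC (h y)) * f y with hg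
  have hgR : ∀ z, |(g z).re| ≤ F := fun z => ((Complex.abs_re_le_norm _).trans_eq (norm_rot h f z)).trans (hF z)
  have hgI : ∀ z, |(g z).im| ≤ F := fun z => ((Complex.abs_im_le_norm _).trans_eq (norm_rot h f z)).trans (hF z)
  have hne : ∀ z, ((g z).re ≠ 0 ∨ (g z).im ≠ 0) → f z ≠ 0 := fun z hz hf => by
    rcases hz with hz | hz
    · exact hz (by simp only [hg, hf, mul_zero, Complex.zero_re])
    · exact hz (by simp only [hg, hf, mul_zero, Complex.zero_im])
  obtain HR := Hα P hPd hPL k hk1 hkK μ x₁ x₂ hx (fun y => (g y).re) F D hgR hD (fun z hz => hs₁ z (hne z (Or.inl hz)))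
    (fun z hz => hs₂ z (hne z (Or.inl hz)))
  obtain HI := Hα P hPd hPL k hk1 hkK μ x₁ x₂ hx (fun y => (g y).im) F D hgI hD (fun z hz => hs₁ z (hne z (Or.inr hz)))
    (fun z hz => hs₂ z (hne z (Or.inr hz)))
  -- remove the phases: h(x₁)h(x₂)⁻¹·h(x₂)·δψ(x₂) − h(x₁)·δψ(x₁) = h(x₁)·(δψ(x₂) − δψ(x₁))
  set ψ : Balaban1983to89.Site P 0 → ℂ := ((B1RG242Torus.tower P a 0).G k).map Complex.ofRealHom *ᵥ g with hψ
  set δψ : Balaban1983to89.Site P 0 → ℂ := fun x => ((P.eps⁻¹ : ℝ) : ℂ) * (ψ (x.shift μ) - ψ x) with hδψ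
  have hcov : ∀ x : Balaban1983to89.Site P 0, covD P.eps⁻¹ (cfg (gaugeAct h (1 : GaugeField P 0 U1)))
      (gBox (B1RG242Torus.α P a k * (P.L : ℝ) ^ (k * P.d)) P.eps⁻¹ (gaugeAct h (1 : GaugeField P 0 U1)) k univ *ᵥ f) ⟨x, μ⟩ =
        toC (h x) * δψ x := fun x => by
    rw [covD_gBox_pureGauge ha hk1 hk]; rfl
  have hx₂ : toC (h x₂) ≠ 0 := toC_ne_zero _
  have hphase : toC (h x₁) * (toC (h x₂))⁻¹ * (toC (h x₂) * δψ x₂) - toC (h x₁) * δψ x₁ = toC (h x₁) * (δψ x₂ - δψ x₁) := by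
    field_simp
  rw [hcov x₂, hcov x₁, hphase, norm_mul, norm_toC, one_mul]
  have hw : 0 ≤ ((P.eps * B5Ineq137Torus.T P 0 x₁ x₂)⁻¹) ^ α :=
    Real.rpow_nonneg (inv_nonneg.mpr (mul_nonneg P.eps_pos.le (B5Ineq137Torus.T_nonneg P 0 x₁ x₂))) α
  have hre : ∀ x : Balaban1983to89.Site P 0, (δψ x).re =
      ((B1RG242Torus.deriv P 0 P.eps μ * (B1RG242Torus.tower P a 0).G k) *ᵥ fun y => (g y).re) x := fun x => by
    rw [hδψ, ← mulVec_mulVec, B1RG242Torus.deriv_mulVec]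
    simp only [Complex.re_ofReal_mul, Complex.sub_re, hψ, re_map_mulVec]
  have him : ∀ x : Balaban1983to89.Site P 0, (δψ x).im =
      ((B1RG242Torus.deriv P 0 P.eps μ * (B1RG242Torus.tower P a 0).G k) *ᵥ fun y => (g y).im) x := fun x => by
    rw [hδψ, ← mulVec_mulVec, B1RG242Torus.deriv_mulVec]
    simp only [Complex.im_ofReal_mul, Complex.sub_im, hψ, im_map_mulVec]
  have E2 : 2 * c₀ * Real.exp (-(δ₀ * (P.eps * D))) * F =
      c₀ * Real.exp (-(δ₀ * (P.eps * D))) * F + c₀ * Real.exp (-(δ₀ * (P.eps * D))) * F := by ring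
  calc ((P.eps * B5Ineq137Torus.T P 0 x₁ x₂)⁻¹) ^ α * ‖δψ x₂ - δψ x₁‖
      ≤ ((P.eps * B5Ineq137Torus.T P 0 x₁ x₂)⁻¹) ^ α * (|(δψ x₂).re - (δψ x₁).re| + |(δψ x₂).im - (δψ x₁).im|) :=
        mul_le_mul_of_nonneg_left (norm_sub_le_re_im _ _) hw
    _ = ((P.eps * B5Ineq137Torus.T P 0 x₁ x₂)⁻¹) ^ α * |(δψ x₂).re - (δψ x₁).re| +
          ((P.eps * B5Ineq137Torus.T P 0 x₁ x₂)⁻¹) ^ α * |(δψ x₂).im - (δψ x₁).im| := mul_add _ _ _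
    _ ≤ c₀ * Real.exp (-(δ₀ * (P.eps * D))) * F + c₀ * Real.exp (-(δ₀ * (P.eps * D))) * F := by
        rw [hre, hre, him, him]; exact add_le_add HR HI
    _ = 2 * c₀ * Real.exp (-(δ₀ * (P.eps * D))) * F := E2.symm

end

end Literature.MathematicalPhysics.QuantumFieldTheory.BalabanImbrieJaffe1984to88.BIJ88NeumannPropagatorFlatDecay
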